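import Summits.QuantumFields.YangMills.Theorems.BalabanUVNodesN16HolderMSSlotWindow
import Summits.QuantumFields.YangMills.Theorems.BalabanUVNodesN16HolderMSAtRecord13CoPH
import Summits.QuantumFields.YangMills.Theorems.BalabanUVNodesRateReadingOfRecord13CoPH
/-!
# Route «BalabanUVNodes», cluster K4 «SpineRates» — node N16 = NE3: THE MS STUB FROM THE MS SLOT AT THE STAGE-13 HOMES OF RECORD (repair R-β″, record kit (F2-MS)) — slot
# closers at exponent `β` (`InEndRegimeHMS ∧ LeafSlotHolderMS · β` once per family ⇒ `S_N16HolderMS β (RRec₁₃CoPHOn ∕ RRec₁₃CoPH …)`), THE WINDOW RECIPE for the MS slot (the class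
# radius inside N05's window makes `LeafSlotHolderMS · β` its three content clauses — N05's leaf on `zdGF3 (M_N ℂ) F.L β len`, N07's `LeafH3sup`), the MS proviso at windowed
# letters, ★ THE MS N16 LINE at RR-1's object (`hpin`-generic) and at dag-n22-e's named reading `readingOfRecord₁₃CoPH`, and its letter-wise non-vacuity at the MS thresholds

CoPH EDITION (FINDING №9 = node00-def-T LOCATED-9 «history-blind residual 𝐓-weight slot»; director-ym №183 H1ʰ ∕ №186 (α) ∕ №190 PRESS WORD; node00-def-T FILE 27 `Node00/Record13CoPH.lean`
p537939 + FILE 28T `Node00/Record13SepCoPH.lean` p539169, T₇ = KEY-RULE-27 ∕ `KEYMAP-Record13-v1.7.md`; plan rev 24; dag-lead DEDUP-301 «v1.7 porters UNGATED → GO» ∕ DEDUP-302 — 2026-08-27):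
RECORD 13 v1.7 indexes the residual 𝐓-weight slot by the WHOLE history — `structure Stage13HParams … extends Stage13RParams` with the fields `Zh : (p : B12.RunParams) → ℕ →
(ℕ → Set (Site (Fam.P p.K) 0)) → (ℕ → Set (Site (Fam.P p.K) 0)) → TkResidualW Fam N (FluctV N) p.K` and `Phih`, readers `zhAt ∕ rzAt`, guard `Stage13HParams.ZhUnity`, proviso
`Stage13HParams.Provisos₁₃CoPH` (rows `zhLaws ∕ zhLocal`), `towerOfRecord₁₃CoPH ∕ datumOfRecord₁₃CoPH`, record class `IsRecordOfRecord₁₃CCoPH`, door `Stage13HParams.ofHistoryBlind`; node00-def-RR-2's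
key `Node00/Record13DatumKeyCoPH` p539151 (`IsDatumOfRecord₁₃CCoPH(On∕N)`, `.params ∕ .provisos ∕ .admissible`, `isDatumOfRecord₁₃CCoPH_datumOfRecord₁₃CoPH`, guard of record `unityNondeg₁₃H`) and
dag-n22-e's (T-RATE) layer-B ∕ reading-of-record CoPH ports (`RateReading₁₃CoPH`, `rateCarriersOfRecord₁₃CoPH`, `RRec₁₃CoPH`, `RRec₁₃CoPHOn`, `readingOfRecord₁₃CoPH`, …) followed; the items re-key to
⁷ (`…R13SepCoPH`, plan rev 24 ∕ dag-lead WORDS-143), bg-blind consumer storeys port their OWN files (director-ym №174 (3) standing).  THIS FILE is the TOKEN TWIN of this seat's v1.6 module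
`…N16HolderMSSlotWindowCoPR` (p540705) under T₇: binder `(θ : Stage13RParams F N) ↦ (θ : Stage13HParams F N)` (regimes `Rg`, run-length selectors `ksel`, tuple readings `rr` re-typed
with it; `θ.Admissible F N` read through the ancestor structures), `Provisos₁₃CoPR ↦ Provisos₁₃CoPH`, every `…CoPR…` record ∕ key ∕ home ∕ reading ∕ module stem `↦ …CoPH…`, guard
`unityNondeg₁₃R ↦ unityNondeg₁₃H` (prose only here) — statements = the v1.6 statements under that map; proofs VERBATIM; θ-free names (RR-1's `ne3ConstLayerOfRecord₁₁` ∕ `ne3NperOfRecord₁₁` ∕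
`ne3DomOfRecord₁₁`, `InEndRegime`, `LeafSlot`, the AT slots, dag-n16-c's β-kit, …) VERBATIM; stage-free lemmas NOT re-declared (imported BY NAME); N16 reads no field of the key (no `Zh ∕ Zr ∕
Zt`, no `bg`, no transport face — T₇'s SITE RULE S₇ has no site in this file); the tuple-currency (K3 `KeyedRates rr`) conjuncts are CITED from this seat's BINDER-GENERIC modules
`…N16AtTupleReadingBinderGeneric` ∕ `…N16HolderMSAtTupleReadingBinderGeneric` (p530924 ∕ p531947: key type, proviso and admissibility are variables — NO port needed at this or any
later edition).  NOTE (LOCATED-4∕5 of dag-n16-e ∕ dag-n16-c): every «THE N16 LINE» keyed on the law-free univ sub-family is VACUOUS as stated (n16-c F49); the LIVE lines carry N05's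
conjunct at the pinned all-torus proper sub-index (`…AllTorusAtRecord13CoPH`).  The v1.6 CoPR ∕ v1.5 CoP ∕ Co ∕ ⁗ ∕ ‴ siblings and the item ids they name are ASIDES; the lane is
K3⁷ `SpineGivenEndpointR13SepCoPH` = stmt-QuantumFields-20544 (plan g73 REV24-BORN l.20848; dag-lead WORDS-143),
filed `--kind proof --supports stmt-QuantumFields-20544 --as helper`.

Cell `pub-ymgap`, seat `pub-ymgap-dag-n16-e` (R134 acceleration seat (a), strategy s2 = BY-NAME KNIT at the record; HUMAN RULING D-0062; chair R424 venue), generation 8,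
module 26ᴴ = (F2-MS) (pub-ymgap INBOX DAGN16E-G6-INTENT-26 l.16577; dag-n16-c g4's division ACK-N16E l.16473), THEOREMS ONLY (0 `def`, 0 `sorry`).  The Stage-13 MS twin of this
seat's (F2) `…N16HolderSlotWindow` (p485315) and module 20 §5 ∕ module 23 §3, over module 25 `…N16HolderMSLeafSlot` (`LeafSlotHolderMS`, the MS closers), module 24
`…N16HolderMSRegime` (`InEndRegimeHMS`, `radiusOfRecordHMS`, `constOfRecordHMS`), module 22 `…N16HolderMSAtRecord13CoPH` (the MS home faces at ₁₃) and file 17 `…N16SlotWindowLinear`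
(the slot-free arithmetic `slotLetterLines`, `leafLines_of_linear`).  `--supports stmt-QuantumFields-19912 --as helper`.  `bears_on: R4∕N16 · edge N05 → N16 · out-edge N16 → N21`.

CONTENT.
§1 CLOSERS AT ONE BUNDLE PER FAMILY — `s_N16HolderMS_rRec₁₃CoPHOn_of_constLayer_leafSlotHolderMS`, `s_N16HolderMS_rRec₁₃CoPH_of_constLayer_leafSlotHolderMS` (module 22's const-layer
  `iff`s `.2` ∘ module 25's closer).
§2 (‴ ONLY, stage-free, imported BY NAME from `…N16HolderMSSlotWindow`): `slotHolderLineMS`, `leafSlotHolderMS_ofRecord_of_window_lines∕_linear`,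
  `inEndRegimeHMS_ofRecord_of_window`, and §3's per-family `inEndRegimeHMS_and_leafSlotHolderMS_ofRecord_of_window_linear` — not re-declared here.
§3 ★ THE MS N16 LINE — `s_N16HolderMS_rRec₁₃CoPHOn_ofRecord_of_window_linear` ∕ `s_N16HolderMS_rRec₁₃CoPH_ofRecord_of_window_linear` (reading pinned at RR-1's object, `hpin`-generic)
  and `s_N16HolderMS_readingOfRecord₁₃CoPHOn_of_window_linear` ∕ `s_N16HolderMS_readingOfRecord₁₃CoPH_of_window_linear` (dag-n22-e's named reading, `rfl`): N05's `Thm4Body` ∕ `Prop3Body`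
  on the univ sub-family of `zdGF3 (M_N ℂ) F.L β (len F)` + N07's `LeafH3sup` ONCE per guarded family ⇒ `S_N16HolderMS β (RRec₁₃CoPHOn 𝔯 Rg)` — VACUOUS AS STATED: the univ-family `Thm4Body` input is UNSATISFIABLE for every
#   `c₁ > 0`, `L ≥ 2` (dag-n16-c F49∕F50; ref-H READ-256 V-256 kernel-certified); the K3 composer's LIVE `h16` under R-β″ is module 36's PINNED edition
#   `N16LinesAllTorusAtRecord13CoPH.s_N16HolderMS_rRec₁₃CoPH(On)_ofRecord_of_window_linear_allTorus` ∕ `…_readingOfRecord₁₃CoPH(On)_of_window_linear_allTorus` over module 33's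
#   `inEndRegimeHMS_and_leafSlotHolderMSAT_ofRecord_of_window_linear`; §1's closers are unaffected
  under R-β″; every other hypothesis a displayed letter line (with the MS length letter `len F (j • e μ) = j`).
§4 (‴ ONLY): `exists_window_letters_numerals_HMS` — stage-free, imported.

HONEST FRAMING.  Kernel bookkeeping by name; no estimate; N05's `Thm4Body` ∕ `Prop3Body` ([Balaban1985RegularSpaces] Thm 4 ∕ Prop 3 as typed by n05-a, all-torus sub-family,
Hölder member at its PRINTED exponent) and N07's `LeafH3sup` ([Balaban1985Variational] Thm 1 (8)+(10) TYPE) are HYPOTHESES asserted for no family; `S_N16HolderMS β` is dag-n16-c's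
CANDIDATE stub wording for R-β″ (UNRULED; nothing of record edited); the reading is a PARAMETER pinned through `hpin` (§3b: dag-n22-e's named reading, whose `w1`∕`ne2`∕`ne1` are
residual DATA); no admissible Stage-13 tuple with provisos is claimed to exist (K0‴ `Record13Inhabited`, stmt-QuantumFields-19909, OPEN); nothing of Bałaban's asserted; **N16 ∕
NE3 is NOT discharged**; count-neutral (typed 28∕28 · discharged 5∕27, A 5∕28 UNMOVED); one finite four-torus at fixed ε — NOT ℝ⁴, NOT infinite volume, NOT OS, NOT a mass gap,
NOT Clay.  No decl below carries a cite tag (all `[folklore]` bookkeeping).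
-/

set_option autoImplicit false

open scoped BigOperators Matrix Matrix.Norms.L2Operator
open NormedSpace

namespace Summit.QuantumFields.YangMills.BalabanUVNodes.N16HolderMSSlotWindowCoPH

open Literature.MathematicalPhysics.QuantumFieldTheory.Balaban1983to89
open Literature.MathematicalPhysics.QuantumFieldTheory.Balaban1983to89.T4Continuum (T4Family ULoop)
open B7Prop1Explicit B7Prop2Explicit
open B7Prop3Flat (c3)
open B8LeafModelZd (ZdIdx)
open B8LeafModelZd3 (zdGF3)
open Node00 (IsDatumOfRecord₁₃CCoPH Stage13HParams NE3Objects₁₁ NE3Letters₁₁ NE2Objects₁₁ ne3ConstLayerOfRecord₁₁ ne3NperOfRecord₁₁ ne3DomOfRecord₁₁ one_le_ne3NperOfRecord₁₁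
  MatA)
open Node00.W1 (ReadingData)
open Summit.QuantumFields.BalabanUV.T4Continuum
open BlockAverageCurrent (curConst curConst_nonneg)
open NE3RightInverseSupLetters (frameC)
open NE3.LeafIndexSockets (LeafH3sup)
open YMDAG.UVSplit (Datum NE3Carriers NE1pCarriers ne3OfRecord₁₁ RateReading₁₃CoPH RRec₁₃CoPH RRec₁₃CoPHOn readingOfRecord₁₃CoPH readingOfRecord₁₃CoPH_ne3)
open Summit.QuantumFields.YangMills.BalabanUVNodes.N16HolderMSDefs (N16HolderMSAt S_N16HolderMS)
open Summit.QuantumFields.YangMills.BalabanUVNodes.N16HolderMSRegime (InEndRegimeHMS radiusOfRecordHMS constOfRecordHMS inEndRegimeHMS_iff radiusOfRecordHMS_pos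
  constOfRecordHMS_nonneg)
open Summit.QuantumFields.YangMills.BalabanUVNodes.N16HolderMSLeafSlot (LeafSlotHolderMS n16HolderMSAt_of_inEndRegimeHMS_leafSlotHolderMS)
open Summit.QuantumFields.YangMills.BalabanUVNodes.N16HolderMSSlotWindow (inEndRegimeHMS_and_leafSlotHolderMS_ofRecord_of_window_linear)
open Summit.QuantumFields.YangMills.BalabanUVNodes.N16HolderMSAtRecord13CoPH (s_N16HolderMS_rRec₁₃CoPHOn_iff_of_constLayer s_N16HolderMS_rRec₁₃CoPH_iff_of_constLayer)

noncomputable section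

variable {N : ℕ} [NeZero N]

/-! ## §1 The MS stub from the MS proviso and the MS slot at ONE bundle per family -/

section ConstLayer

variable {β : ℝ} (hβ0 : 0 ≤ β) (hβ1 : β ≤ 1) (𝔯 : RateReading₁₃CoPH N) (Rg : (F : T4Family) → Stage13HParams F N → Prop) (o : T4Family → NE3Objects₁₁ N)
include hβ0 hβ1

/-- **THE KNIT AT A CONSTANT LAYER, MS LEAF FORM, REGIME-RESTRICTED HOME** (`0 ≤ β ≤ 1`): for a reading whose NE3 component is constantly `o F`, the MS proviso
`InEndRegimeHMS` and the MS slot `LeafSlotHolderMS · β` at the ONE bundle `ne3OfRecord₁₁ F (o F)` of every guarded family give `S_N16HolderMS β (RRec₁₃CoPHOn 𝔯 Rg)` (module 25's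
closer once per family under module 22's const-layer face). [folklore] -/
theorem s_N16HolderMS_rRec₁₃CoPHOn_of_constLayer_leafSlotHolderMS
    (hpin : ∀ (F : T4Family) (θ : Stage13HParams F N) (hP : θ.Provisos₁₃CoPH F N) (g₀ : ℕ → ℝ) (os : List (ULoop F)) (k : ℕ), (𝔯.lit F θ hP g₀ os).ne3 k = o F)
    (h : ∀ (F : T4Family), (∃ θ : Stage13HParams F N, θ.Provisos₁₃CoPH F N ∧ Rg F θ ∧ θ.Admissible F N) →
      InEndRegimeHMS (ne3OfRecord₁₁ F (o F)) ∧ LeafSlotHolderMS (ne3OfRecord₁₁ F (o F)) β) :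
    S_N16HolderMS β (RRec₁₃CoPHOn 𝔯 Rg) :=
  (s_N16HolderMS_rRec₁₃CoPHOn_iff_of_constLayer β 𝔯 Rg o hpin).2 fun F hF => n16HolderMSAt_of_inEndRegimeHMS_leafSlotHolderMS (h F hF).1 hβ0 hβ1 (h F hF).2

/-- **THE KNIT AT A CONSTANT LAYER, MS LEAF FORM, CANONICAL HOME** (`0 ≤ β ≤ 1`). [folklore] -/
theorem s_N16HolderMS_rRec₁₃CoPH_of_constLayer_leafSlotHolderMS
    (hpin : ∀ (F : T4Family) (θ : Stage13HParams F N) (hP : θ.Provisos₁₃CoPH F N) (g₀ : ℕ → ℝ) (os : List (ULoop F)) (k : ℕ), (𝔯.lit F θ hP g₀ os).ne3 k = o F)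
    (h : ∀ (F : T4Family), (∃ D : Datum F N, IsDatumOfRecord₁₃CCoPH F N D) → InEndRegimeHMS (ne3OfRecord₁₁ F (o F)) ∧ LeafSlotHolderMS (ne3OfRecord₁₁ F (o F)) β) :
    S_N16HolderMS β (RRec₁₃CoPH 𝔯) :=
  (s_N16HolderMS_rRec₁₃CoPH_iff_of_constLayer β 𝔯 o hpin).2 fun F hF => n16HolderMSAt_of_inEndRegimeHMS_leafSlotHolderMS (h F hF).1 hβ0 hβ1 (h F hF).2

end ConstLayer

/-! ## §3 ★ THE MS N16 LINE — at RR-1's object of record (`hpin`-generic) and at dag-n22-e's named reading `readingOfRecord₁₃CoPH`, windowed letters, linear currency -/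

section Line

variable {β : ℝ} (hβ0 : 0 ≤ β) (hβ1 : β ≤ 1) (Rg : (F : T4Family) → Stage13HParams F N → Prop) (ℓ : T4Family → NE3Letters₁₁)
  -- N05's constants, per family (MS length letter); the averaging letter in N05's window and N07's leaf letters, per family
  {len : T4Family → Site 4 → ℝ} {c₁ c₁' B₁' cP C₂ B₀β : T4Family → ℝ} {inp : T4Family → B8.B9Inputs} {α b' c' : T4Family → ℝ}
  (hlen : ∀ (F : T4Family) (v : Site 4), 0 < len F v → 1 ≤ len F v) (hlenj : ∀ (F : T4Family) (μ : Fin 4) (j : ℕ), len F (j • e μ) = j)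
  (hB₁' : ∀ F, 0 < B₁' F) (hBB : ∀ F : T4Family, 5 * ((4 : ℕ) : ℝ) * F.L * (inp F).B₀ ≤ B₁' F) (hc₁' : ∀ F, 0 < c₁' F)
  (hwin : ∀ (F : T4Family) (α₀ α₁ : ℝ), 0 < α₀ → 0 < α₁ → α₀ + α₁ ≤ c₁' F →
    α₀ + α₁ ≤ c₁ F ∧ C0 4 * (2 * α₀) ≤ 1 / 3 ∧ 4 * α₀ ≤ c2' 4 F.L ∧ 16 * (B₁' F * (α₀ + α₁)) ≤ 1 ∧
    Real.exp (4 * (800 * (((4 : ℕ) : ℝ) + 1) ^ 2 * (((4 : ℕ) : ℝ) + 4)) * α₀) * (1 + 8 * (131072 * (((4 : ℕ) : ℝ) + 1) ^ 2) * (B₁' F * (α₀ + α₁))) ≤ 2 ∧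
    2 * (B₁' F * (α₀ + α₁)) ≤ c3 4 F.L ∧ ((4 : ℕ) : ℝ) * F.L * α₁ ≤ 1 / 8 ∧ α₀ ≤ cP F ∧ α₁ ≤ cP F ∧ B₁' F * (α₀ + α₁) ≤ cP F ∧
    2 * (B₁' F * (α₀ + α₁)) ^ 2 + 20 * ((4 : ℕ) : ℝ) * α₀ * (B₁' F * (α₀ + α₁)) + 2 * C₂ F * (B₁' F * (α₀ + α₁)) ^ 2 ≤ α₀ + α₁)
  (hα : ∀ F, 0 < α F) (hα1 : ∀ F, α F ≤ c₁' F / 177)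
  (hα2 : ∀ F : T4Family, α F ≤ (ℓ F).Λ₁ / (1770 * (5 * ((4 : ℕ) : ℝ) * F.L * (inp F).B₀) + 1))
  (hα3 : ∀ F : T4Family, α F ≤ c2' 4 F.L / 2)
  (hα4 : ∀ F : T4Family, α F ≤ 1 / ((23040 * (4 : ℝ) ^ 4 * (frameC 4 F.L + 4) ^ 3 + 12) * (1 + curConst 4 F.L) + 1))
  (hα5 : ∀ F, α F ≤ 1 / 10 ^ 9)
  (hg : ∀ F, 0 < (ℓ F).g) (hε0 : ∀ F, 0 < (ℓ F).ε) (hε : ∀ F, (ℓ F).ε < α F)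
  (hΛ₁r : ∀ F : T4Family, (ℓ F).Λ₁ ≤ radiusOfRecordHMS N F.L (ne3NperOfRecord₁₁ F 0 0))
  (hb : ∀ F, 0 ≤ (ℓ F).b ∧ (ℓ F).b ≤ (ℓ F).ε / 2) (hC : ∀ F : T4Family, constOfRecordHMS N F.L (ne3NperOfRecord₁₁ F 0 0) (ℓ F).g ≤ (ℓ F).C)
  (hΛ₂' : ∀ F : T4Family, 177 * α F * (5 * ((4 : ℕ) : ℝ) * F.L * B₀β F + 5 * ((4 : ℕ) : ℝ) * F.L * (inp F).B₀) ≤ (ℓ F).Λ₂')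
  (hb' : ∀ F, 0 ≤ b' F ∧ b' F ≤ α F / 2048) (hc' : ∀ F, 0 ≤ c' F ∧ c' F ≤ α F / 24)
include hβ0 hβ1 hlen hlenj hB₁' hBB hc₁' hwin hα hα1 hα2 hα3 hα4 hα5 hg hε0 hε hΛ₁r hb hC hΛ₂' hb' hc'

/-- ★ **THE MS N16 LINE AT THE REGIME-RESTRICTED STAGE-13 HOME, READING PINNED AT RR-1's OBJECT** (`0 ≤ β ≤ 1`; `hpin`-generic) — with windowed letters `ℓ F` (lines displayed),
the three content clauses (N05's `Thm4Body` ∕ `Prop3Body` on the univ sub-family of `zdGF3 (M_N ℂ) F.L β (len F)`, N07's `LeafH3sup` at `(ℓ F).ε, b' F, c' F`) ONCE per guarded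
family give `S_N16HolderMS β (RRec₁₃CoPHOn 𝔯 Rg)` — TRUE BUT EMPTY (the univ-family `Thm4Body` premise is unsatisfiable: F49∕F50, ref-H V-256); the live R-β″ `h16` is
module 36's `s_N16HolderMS_rRec₁₃CoPHOn_ofRecord_of_window_linear_allTorus` (pinned sub-index). [folklore] -/
theorem s_N16HolderMS_rRec₁₃CoPHOn_ofRecord_of_window_linear (𝔯 : RateReading₁₃CoPH N)
    (hpin : ∀ (F : T4Family) (θ : Stage13HParams F N) (hP : θ.Provisos₁₃CoPH F N) (g₀ : ℕ → ℝ) (os : List (ULoop F)) (k : ℕ),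
      (𝔯.lit F θ hP g₀ os).ne3 k = ne3ConstLayerOfRecord₁₁ F N (ℓ F))
    (hcontent : ∀ (F : T4Family), (∃ θ : Stage13HParams F N, θ.Provisos₁₃CoPH F N ∧ Rg F θ ∧ θ.Admissible F N) →
      letI : CStarAlgebra (Matrix (Fin N) (Fin N) ℂ) := {}
      B8.Thm4Body (c₁ F) (B₁' F) (fun i : {i : ZdIdx 4 F.L // i.Ω 0 = Set.univ} => (zdGF3 (Matrix (Fin N) (Fin N) ℂ) F.L β (len F) i.1).toGFData) ∧
        B8.Prop3Body (cP F) 4 (F.L : ℝ) (C₂ F) (inp F) (B₀β F)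
          (fun i : {i : ZdIdx 4 F.L // i.Ω 0 = Set.univ} => (zdGF3 (Matrix (Fin N) (Fin N) ℂ) F.L β (len F) i.1).toGFData2) ∧
        LeafH3sup 4 F.L (ne3NperOfRecord₁₁ F 0 0) (ℓ F).ε (b' F) (c' F) (ne3DomOfRecord₁₁ F N 0 0)) :
    S_N16HolderMS β (RRec₁₃CoPHOn 𝔯 Rg) :=
  s_N16HolderMS_rRec₁₃CoPHOn_of_constLayer_leafSlotHolderMS hβ0 hβ1 𝔯 Rg (fun F => ne3ConstLayerOfRecord₁₁ F N (ℓ F)) hpin fun F hF =>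
    inEndRegimeHMS_and_leafSlotHolderMS_ofRecord_of_window_linear ℓ hlen hlenj hB₁' hBB hc₁' hwin hα hα1 hα2 hα3 hα4 hα5 hg hε0 hε hΛ₁r hb hC hΛ₂' hb' hc' F
      (hcontent F hF).1 (hcontent F hF).2.1 (hcontent F hF).2.2

/-- **THE MS N16 LINE AT THE CANONICAL STAGE-13 HOME `RRec₁₃CoPH 𝔯`, READING PINNED AT RR-1's OBJECT** (content once per family carrying a Stage-13 datum of record). [folklore] -/
theorem s_N16HolderMS_rRec₁₃CoPH_ofRecord_of_window_linear (𝔯 : RateReading₁₃CoPH N)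
    (hpin : ∀ (F : T4Family) (θ : Stage13HParams F N) (hP : θ.Provisos₁₃CoPH F N) (g₀ : ℕ → ℝ) (os : List (ULoop F)) (k : ℕ),
      (𝔯.lit F θ hP g₀ os).ne3 k = ne3ConstLayerOfRecord₁₁ F N (ℓ F))
    (hcontent : ∀ (F : T4Family), (∃ D : Datum F N, IsDatumOfRecord₁₃CCoPH F N D) →
      letI : CStarAlgebra (Matrix (Fin N) (Fin N) ℂ) := {}
      B8.Thm4Body (c₁ F) (B₁' F) (fun i : {i : ZdIdx 4 F.L // i.Ω 0 = Set.univ} => (zdGF3 (Matrix (Fin N) (Fin N) ℂ) F.L β (len F) i.1).toGFData) ∧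
        B8.Prop3Body (cP F) 4 (F.L : ℝ) (C₂ F) (inp F) (B₀β F)
          (fun i : {i : ZdIdx 4 F.L // i.Ω 0 = Set.univ} => (zdGF3 (Matrix (Fin N) (Fin N) ℂ) F.L β (len F) i.1).toGFData2) ∧
        LeafH3sup 4 F.L (ne3NperOfRecord₁₁ F 0 0) (ℓ F).ε (b' F) (c' F) (ne3DomOfRecord₁₁ F N 0 0)) :
    S_N16HolderMS β (RRec₁₃CoPH 𝔯) :=
  s_N16HolderMS_rRec₁₃CoPH_of_constLayer_leafSlotHolderMS hβ0 hβ1 𝔯 (fun F => ne3ConstLayerOfRecord₁₁ F N (ℓ F)) hpin fun F hF =>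
    inEndRegimeHMS_and_leafSlotHolderMS_ofRecord_of_window_linear ℓ hlen hlenj hB₁' hBB hc₁' hwin hα hα1 hα2 hα3 hα4 hα5 hg hε0 hε hΛ₁r hb hC hΛ₂' hb' hc' F
      (hcontent F hF).1 (hcontent F hF).2.1 (hcontent F hF).2.2

variable (w1 : (F : T4Family) → (θ : Stage13HParams F N) → ReadingData F (MatA N) θ.τ9.M)
  (ne2 : (F : T4Family) → Stage13HParams F N → (ℕ → ℝ) → List (ULoop F) → ℕ → NE2Objects₁₁)
  (ne1 : (F : T4Family) → Stage13HParams F N → (ℕ → ℝ) → List (ULoop F) → NE1pCarriers)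

/-- ★ **THE MS N16 LINE AT dag-n22-e's NAMED READING OF RECORD, REGIME-RESTRICTED** (`hpin := readingOfRecord₁₃CoPH_ne3`, `rfl`): with the reading's letters `ℓ`, the three content
clauses once per guarded family give `S_N16HolderMS β (RRec₁₃CoPHOn (readingOfRecord₁₃CoPH w1 ℓ ne2 ne1) Rg)`. [folklore] -/
theorem s_N16HolderMS_readingOfRecord₁₃CoPHOn_of_window_linear
    (hcontent : ∀ (F : T4Family), (∃ θ : Stage13HParams F N, θ.Provisos₁₃CoPH F N ∧ Rg F θ ∧ θ.Admissible F N) →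
      letI : CStarAlgebra (Matrix (Fin N) (Fin N) ℂ) := {}
      B8.Thm4Body (c₁ F) (B₁' F) (fun i : {i : ZdIdx 4 F.L // i.Ω 0 = Set.univ} => (zdGF3 (Matrix (Fin N) (Fin N) ℂ) F.L β (len F) i.1).toGFData) ∧
        B8.Prop3Body (cP F) 4 (F.L : ℝ) (C₂ F) (inp F) (B₀β F)
          (fun i : {i : ZdIdx 4 F.L // i.Ω 0 = Set.univ} => (zdGF3 (Matrix (Fin N) (Fin N) ℂ) F.L β (len F) i.1).toGFData2) ∧
        LeafH3sup 4 F.L (ne3NperOfRecord₁₁ F 0 0) (ℓ F).ε (b' F) (c' F) (ne3DomOfRecord₁₁ F N 0 0)) :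
    S_N16HolderMS β (RRec₁₃CoPHOn (readingOfRecord₁₃CoPH w1 ℓ ne2 ne1) Rg) :=
  s_N16HolderMS_rRec₁₃CoPHOn_ofRecord_of_window_linear hβ0 hβ1 Rg ℓ hlen hlenj hB₁' hBB hc₁' hwin hα hα1 hα2 hα3 hα4 hα5 hg hε0 hε hΛ₁r hb hC hΛ₂' hb' hc' _
    (readingOfRecord₁₃CoPH_ne3 w1 ℓ ne2 ne1) hcontent

/-- **THE MS N16 LINE AT dag-n22-e's NAMED READING OF RECORD, CANONICAL HOME** (content once per family carrying a Stage-13 datum of record). [folklore] -/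
theorem s_N16HolderMS_readingOfRecord₁₃CoPH_of_window_linear
    (hcontent : ∀ (F : T4Family), (∃ D : Datum F N, IsDatumOfRecord₁₃CCoPH F N D) →
      letI : CStarAlgebra (Matrix (Fin N) (Fin N) ℂ) := {}
      B8.Thm4Body (c₁ F) (B₁' F) (fun i : {i : ZdIdx 4 F.L // i.Ω 0 = Set.univ} => (zdGF3 (Matrix (Fin N) (Fin N) ℂ) F.L β (len F) i.1).toGFData) ∧
        B8.Prop3Body (cP F) 4 (F.L : ℝ) (C₂ F) (inp F) (B₀β F)
          (fun i : {i : ZdIdx 4 F.L // i.Ω 0 = Set.univ} => (zdGF3 (Matrix (Fin N) (Fin N) ℂ) F.L β (len F) i.1).toGFData2) ∧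
        LeafH3sup 4 F.L (ne3NperOfRecord₁₁ F 0 0) (ℓ F).ε (b' F) (c' F) (ne3DomOfRecord₁₁ F N 0 0)) :
    S_N16HolderMS β (RRec₁₃CoPH (readingOfRecord₁₃CoPH w1 ℓ ne2 ne1)) :=
  s_N16HolderMS_rRec₁₃CoPH_ofRecord_of_window_linear hβ0 hβ1 ℓ hlen hlenj hB₁' hBB hc₁' hwin hα hα1 hα2 hα3 hα4 hα5 hg hε0 hε hΛ₁r hb hC hΛ₂' hb' hc' _
    (readingOfRecord₁₃CoPH_ne3 w1 ℓ ne2 ne1) hcontent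

end Line

end

end Summit.QuantumFields.YangMills.BalabanUVNodes.N16HolderMSSlotWindowCoPH
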